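import Literature.AlgebraicGeometry.HodgeTheory.FermatHodgeCharacterCriterion
import HarnessLib

/-!
# The Hodge condition at the top conductor `f = m`: the unit coordinates are annihilated (Aoki 1983, Prop. 2.2; §9)

Support file XIX (everything PROVED; no named facts, no definitions) for the structure theorem of
the Hodge characters of the Fermat surface (`AokiShioda1983_thmB2m_standard`), companion of
`FermatHodgeCharacterCriterion` (I: `IsHodge.aoki_criterion`) and `FermatHodgeLevelGlue` (XVI:
`IsHodge.units_top_rel`, the case where ALL coordinates are units).

N. Aoki, *On some arithmetic problems related to the Hodge cycles on the Fermat varieties*, Math.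
Ann. **266** (1983) 23–54. Prop. 2.2 (p. 29): "`α ∈ 𝔅ₘ ⇒ τ_{m/f}(α) ∈ A(f)` for every `f ∣ m`";
at the conductor `f = m` only the coordinates of exact level `m` — the units — meet the
conductor (Prop. 2.1), with weight `1` and Euler factor `∏_{p ∣ m} (1 - χ(p)) = 1`. This is
Aoki's operator `τ₁` in §9: "(II) `N = 3` … `τ₁(α) = (1, a, b) ∈ A(m)`" (p. 48), "(III) `N = 2`
… Since `τ₁(α) = (1, a) ∈ A(m, 2)`, we have `a = -u_ε v_δ`" (p. 49) (GDZ scan read: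
`run/shared/lean/pub/pub-hfermat/lit/scans/Aoki1983MA/page48.png`, `page49.png`).

HERE, for any level `m` and a Hodge character `α : Fin r → ℤ/m` (`FermatCharacter.IsHodge`):
* **`IsHodge.unitTerms_top_rel`**: `∑_{αᵢ unit} χ(αᵢ) = 0` for every odd primitive character
  `χ` mod `m` (there is one iff `m` is odd or divisible by `4`, `m ∉ {1, 12}`); the non-unit
  coordinates do not meet the conductor `m`.
Used by `FermatSurfaceHodgeCharacterThriceCoprimeSix` (route K₃, `m = 3m''`) and the planned
`m = 4m'` file (route K₄).

HONEST FRAMING (cell `pub-hfermat`): explicit algebraic cycles for specific Hodge classes on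
Fermat/Delsarte varieties; residual open instances listed; no claim on general Hodge. (This file
reproduces a printed step of a structure theorem for `𝔅²ₘ`; surface classes are algebraic by
Lefschetz (1,1).)

## References

* [Aoki1983] N. Aoki, Math. Ann. 266 (1983) 23–54: Props. 2.1–2.2 (pp. 28–29), §9 (II)–(IV)
  pp. 48–52.
-/

noncomputable section

open Finset

namespace Literature.AlgebraicGeometry.HodgeTheory

namespace FermatCharacter

section TopLevel

variable {m : ℕ}

/-- **[Aoki1983, Prop. 2.2] at the conductor `f = m`: `∑_{αᵢ unit} χ(αᵢ) = 0`** for every odd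
primitive character `χ` mod `m` and every Hodge character `α` of level `m` (only the coordinates
of exact level `m`, i.e. the units, meet the conductor `m`, with weight `1` and Euler factor `1`;
`IsHodge.aoki_criterion` with `f = m`, then complex conjugation). Aoki's "`τ₁(α) ∈ A(m)`" of
§9 (II)–(IV); `FermatHodgeLevelGlue.IsHodge.units_top_rel` is the case of unit coordinates only.
[cite: Aoki1983, Prop. 2.2; §9 (II)–(IV) pp. 48–52] -/
theorem IsHodge.unitTerms_top_rel [NeZero m] {r : ℕ} {α : Fin r → ZMod m} (h : IsHodge α)
    (χ : DirichletCharacter ℂ m) (hχ : χ.Odd) (hprim : χ.IsPrimitive) :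
    ∑ i, (if IsUnit (α i) then χ (α i) else 0) = 0 := by
  classical
  have hm0 : m ≠ 0 := NeZero.ne m
  have H := fun i ↦ exists_unit_lift_eq (m := m) (α i)
  choose w hwu hwx using fun i ↦ (H i).2
  haveI hMi : ∀ i, NeZero (m / m.gcd (α i).val) := fun i ↦
    ⟨(Nat.div_pos (Nat.le_of_dvd (NeZero.pos m) (Nat.gcd_dvd_left _ _))
      (Nat.gcd_pos_of_pos_left _ (NeZero.pos m))).ne'⟩
  have key := h.aoki_criterion (dvd_refl m) hχ hprim (fun i ↦ m / m.gcd (α i).val)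
    (fun i ↦ (H i).1) w hwu (fun i ↦ (hwx i).symm)
  -- conjugate: `(χ y)⁻¹ = conj (χ y)`
  have hinv : ∀ y : ZMod m, (χ y)⁻¹ = starRingEnd ℂ (χ y) := by
    intro y
    by_cases hy : IsUnit y
    · exact Complex.inv_eq_conj (χ.unit_norm_eq_one hy.unit ▸ by rw [IsUnit.unit_spec])
    · rw [χ.map_nonunit hy, inv_zero, map_zero]
  -- identify the terms: `m ∣ Mᵢ` iff `αᵢ` is a unit, and then the term is `χ(αᵢ)⁻¹`
  have hterm : ∀ i, (if m ∣ m / m.gcd (α i).val then ((m.totient : ℂ) / ((m / m.gcd (α i).val).totient : ℂ)) *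
      (∏ p ∈ (m / m.gcd (α i).val).primeFactors, (1 - χ p)) * (χ (ZMod.cast (w i) : ZMod m))⁻¹ else 0) =
      starRingEnd ℂ (if IsUnit (α i) then χ (α i) else 0) := by
    intro i
    have hfac : m / (m / m.gcd (α i).val) = m.gcd (α i).val :=
      Nat.div_div_self (Nat.gcd_dvd_left _ _) hm0
    by_cases hui : IsUnit (α i)
    · have hg1 : m.gcd (α i).val = 1 := by
        have hc := hui
        rw [← ZMod.natCast_zmod_val (α i), ZMod.isUnit_iff_coprime] at hc
        rw [Nat.gcd_comm]; exact hc
      have hM : m / m.gcd (α i).val = m := by rw [hg1, Nat.div_one]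
      have hwi : (ZMod.cast (w i) : ZMod m) = α i := by
        have e := hwx i
        have h1 : ((m / (m / m.gcd (α i).val) : ℕ) : ZMod m) = 1 := by
          rw [hfac, hg1, Nat.cast_one]
        rw [h1, one_mul] at e
        rw [ZMod.cast_eq_val]; exact e
      have hone : (∏ p ∈ m.primeFactors, (1 - χ (p : ZMod m))) = 1 := by
        refine Finset.prod_eq_one fun p hp ↦ ?_
        have hpm : p ∣ m := Nat.dvd_of_mem_primeFactors hp
        have hp1 : p.Prime := Nat.prime_of_mem_primeFactors hp
        have hnu : ¬ IsUnit ((p : ℕ) : ZMod m) := by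
          rw [ZMod.isUnit_iff_coprime]
          intro hc
          exact hp1.one_lt.ne' (Nat.Coprime.eq_one_of_dvd hc hpm)
        rw [χ.map_nonunit hnu, sub_zero]
      have hφ : ((m.totient : ℂ)) / (m.totient : ℂ) = 1 :=
        div_self (by exact_mod_cast (Nat.totient_pos.mpr (Nat.pos_of_ne_zero hm0)).ne')
      rw [if_pos hui, hwi, if_pos (by rw [hM]), hM, hone, hφ, one_mul, one_mul, hinv]
    · have hM : ¬ m ∣ m / m.gcd (α i).val := by
        intro hdvd
        apply hui
        have hMeq : m / m.gcd (α i).val = m := Nat.dvd_antisymm (H i).1 hdvd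
        have hg1 : m.gcd (α i).val = 1 := by
          rcases Nat.div_eq_self.mp hMeq with h0 | h1
          · exact absurd h0 hm0
          · exact h1
        rw [← ZMod.natCast_zmod_val (α i), ZMod.isUnit_iff_coprime, Nat.coprime_iff_gcd_eq_one,
          Nat.gcd_comm]
        exact hg1
      rw [if_neg hM, if_neg hui, map_zero]
  rw [Finset.sum_congr rfl fun i _ ↦ hterm i, ← map_sum] at key
  have := congrArg (starRingEnd ℂ) key
  rwa [starRingEnd_self_apply, map_zero] at this

end TopLevel

end FermatCharacter

end Literature.AlgebraicGeometry.HodgeTheory
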